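import Summits.CriticalPhenomena.CardyFormulaZ2.Theorems.CardyMeckeFlipMeckeRigidityCrossingContinuity
import Mathlib.MeasureTheory.Measure.Typeclasses.Probability

/-!
# Exact self-duality makes crossing-cylinder probabilities continuous in the family of quads

Route `Summits/CriticalPhenomena/CardyFormulaZ2/Theses/CardyMeckeFlip`, crux `MeckeRigidity`
(item stmt-CriticalPhenomena-14826), line `registered`, stub
`continuous_measureReal_iInter_crossedEvent` (support for the closed scale stabiliser,
`map_dilate_eq_self_of_tendsto`).

The `n`-quad version of `continuous_measureReal_crossedEvent`: for an exactly self-dual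
probability law `P` on the Schramm–Smirnov space `ℋ_ℂ` (hypothesis (D): self-duality on crossing
cylinders via transposed quads), the map `(Qᵢ)ᵢ ↦ P(⋂ᵢ ⊞_{Qᵢ})` is continuous on
`Fin n → 𝒬_ℂ` (product of the uniform metrics).

* **Upper semicontinuity, every finite law** (`measureReal_iInter_crossedEvent_le_add_of_dist_lt`,
  `measureReal_iUnion_crossedEvent_le_add_of_dist_lt`): `⊞_Q = ⋂ₖ V_{B(Q,1/(k+1))}`
  (`crossedEvent_eq_iInter_someCrossed`), so both `⋂ᵢ ⊞_{Qᵢ}` and `⋃ᵢ ⊞_{Qᵢ}` are decreasing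
  intersections of the open cylinders `⋂ᵢ V_{B(Qᵢ,1/(k+1))}` resp. `⋃ᵢ V_{B(Qᵢ,1/(k+1))}` (for the
  union one exchanges `⋂ₖ` with a FINITE `⋃ᵢ` of decreasing families,
  `cylinder_iInter_iUnion_of_antitone`), and a family `Q'` with `dist (Q'ᵢ) (Qᵢ) < 1/(k+1)` has
  its cylinder inside the `k`-th one.
* **Lower semicontinuity from (D)** (`measureReal_iInter_crossedEvent_eq_one_sub_transpose`):
  with `A = {univ}`, (D) reads `P(⋂ᵢ ⊞_{Qᵢ}) = P(⋂ᵢ V^{Qtᵢ}) = 1 - P(⋃ᵢ ⊞_{Qtᵢ})` for transposes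
  `Qtᵢ`; choosing the `1`-Lipschitz cyclic transposes of `exists_cyclicTranspose_lipschitz`, upper
  semicontinuity of the union at `(Qtᵢ)ᵢ` is lower semicontinuity of the intersection at `(Qᵢ)ᵢ`.
-/

noncomputable section

open scoped unitInterval ENNReal
open MeasureTheory Set Metric Filter Topology
open Literature.Probability.Percolation Literature.Probability.Percolation.QuadCrossing

namespace Summit.CriticalPhenomena.CardyFormulaZ2.Theorems.CardyMeckeFlip

variable {D : Set ℂ}

/-! ### Set algebra: cylinders as decreasing intersections of open cylinders -/

/-- For a FINITE family of decreasing sequences of sets, `⋂ₖ ⋃ᵢ Aᵢ(k) = ⋃ᵢ ⋂ₖ Aᵢ(k)`: if `S`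
misses `Aᵢ(kᵢ)` for every `i`, it misses every `Aᵢ(K)` for `K = maxᵢ kᵢ`. [folklore] -/
theorem cylinder_iInter_iUnion_of_antitone {ι α : Type*} [Finite ι] (A : ι → ℕ → Set α)
    (hA : ∀ i, Antitone (A i)) : ⋂ k, ⋃ i, A i k = ⋃ i, ⋂ k, A i k := by
  refine subset_antisymm (fun S hS => ?_) iUnion_iInter_subset
  by_contra h
  simp only [mem_iUnion, mem_iInter, not_exists, not_forall] at h
  choose k hk using h
  obtain ⟨K, hK⟩ := Finite.exists_le k
  obtain ⟨i, hi⟩ := mem_iUnion.1 (mem_iInter.1 hS K)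
  exact hk i (hA i (hK i) hi)

/-- The neighbourhood events `V_{B(Q,1/(k+1))}` decrease in `k`. [folklore] -/
theorem cylinder_antitone_someCrossed_ball (Q : Quad D) :
    Antitone fun k : ℕ => QuadConfig.someCrossed (ball Q (1 / ((k : ℝ) + 1))) := by
  intro m n hmn S hS
  obtain ⟨Q', hQ'S, hQ'⟩ := hS
  refine ⟨Q', hQ'S, ball_subset_ball ?_ hQ'⟩
  exact one_div_le_one_div_of_le (by positivity) (by exact_mod_cast Nat.succ_le_succ hmn)

/-- `⋂ᵢ ⊞_{Qᵢ} = ⋂ₖ ⋂ᵢ V_{B(Qᵢ,1/(k+1))}`. [folklore] -/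
theorem iInter_crossedEvent_eq_iInter_someCrossed {ι : Type*} (Q : ι → Quad D) :
    ⋂ i, QuadConfig.crossedEvent (Q i) =
      ⋂ k : ℕ, ⋂ i, QuadConfig.someCrossed (ball (Q i) (1 / ((k : ℝ) + 1))) :=
  calc ⋂ i, QuadConfig.crossedEvent (Q i)
      = ⋂ i, ⋂ k : ℕ, QuadConfig.someCrossed (ball (Q i) (1 / ((k : ℝ) + 1))) :=
        iInter_congr fun i => crossedEvent_eq_iInter_someCrossed (Q i)
    _ = ⋂ k : ℕ, ⋂ i, QuadConfig.someCrossed (ball (Q i) (1 / ((k : ℝ) + 1))) := iInter_comm _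

/-- `⋃ᵢ ⊞_{Qᵢ} = ⋂ₖ ⋃ᵢ V_{B(Qᵢ,1/(k+1))}` for a finite family. [folklore] -/
theorem iUnion_crossedEvent_eq_iInter_someCrossed {ι : Type*} [Finite ι] (Q : ι → Quad D) :
    ⋃ i, QuadConfig.crossedEvent (Q i) =
      ⋂ k : ℕ, ⋃ i, QuadConfig.someCrossed (ball (Q i) (1 / ((k : ℝ) + 1))) := by
  rw [cylinder_iInter_iUnion_of_antitone
    (fun i (k : ℕ) => QuadConfig.someCrossed (ball (Q i) (1 / ((k : ℝ) + 1))))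
    (fun i => cylinder_antitone_someCrossed_ball (Q i))]
  exact iUnion_congr fun i => crossedEvent_eq_iInter_someCrossed (Q i)

/-! ### Upper semicontinuity of `P(⋂ᵢ ⊞_{Qᵢ})` and `P(⋃ᵢ ⊞_{Qᵢ})` for every finite law -/

/-- The masses of `⋂ᵢ V_{B(Qᵢ,1/(k+1))}` decrease to `P(⋂ᵢ ⊞_{Qᵢ})`. [folklore] -/
theorem cylinder_tendsto_measure_iInter_someCrossed {ι : Type*} [Countable ι]
    (P : Measure (QuadConfig D)) [IsFiniteMeasure P] (Q : ι → Quad D) :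
    Tendsto (fun k : ℕ => P (⋂ i, QuadConfig.someCrossed (ball (Q i) (1 / ((k : ℝ) + 1)))))
      atTop (𝓝 (P (⋂ i, QuadConfig.crossedEvent (Q i)))) := by
  rw [iInter_crossedEvent_eq_iInter_someCrossed]
  refine tendsto_measure_iInter_atTop (fun k => ?_) (fun m n hmn => ?_) ⟨0, measure_ne_top P _⟩
  · exact (MeasurableSet.iInter fun i =>
      (QuadConfig.isOpen_someCrossed isOpen_ball).measurableSet).nullMeasurableSet
  · exact iInter_mono fun i => cylinder_antitone_someCrossed_ball (Q i) hmn

/-- The masses of `⋃ᵢ V_{B(Qᵢ,1/(k+1))}` decrease to `P(⋃ᵢ ⊞_{Qᵢ})` (finite family). [folklore] -/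
theorem cylinder_tendsto_measure_iUnion_someCrossed {ι : Type*} [Finite ι]
    (P : Measure (QuadConfig D)) [IsFiniteMeasure P] (Q : ι → Quad D) :
    Tendsto (fun k : ℕ => P (⋃ i, QuadConfig.someCrossed (ball (Q i) (1 / ((k : ℝ) + 1)))))
      atTop (𝓝 (P (⋃ i, QuadConfig.crossedEvent (Q i)))) := by
  rw [iUnion_crossedEvent_eq_iInter_someCrossed]
  refine tendsto_measure_iInter_atTop (fun k => ?_) (fun m n hmn => ?_) ⟨0, measure_ne_top P _⟩
  · have : Countable ι := Finite.to_countable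
    exact (MeasurableSet.iUnion fun i =>
      (QuadConfig.isOpen_someCrossed isOpen_ball).measurableSet).nullMeasurableSet
  · exact iUnion_mono fun i => cylinder_antitone_someCrossed_ball (Q i) hmn

/-- **Upper semicontinuity of crossing cylinders**: for every finite law, families of quads
coordinatewise close to `(Qᵢ)ᵢ` are simultaneously crossed with probability at most
`P(⋂ᵢ ⊞_{Qᵢ}) + ε`. [folklore] -/
theorem measureReal_iInter_crossedEvent_le_add_of_dist_lt {ι : Type*} [Countable ι]
    (P : Measure (QuadConfig D)) [IsFiniteMeasure P] (Q : ι → Quad D) {ε : ℝ} (hε : 0 < ε) :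
    ∃ δ > 0, ∀ Q' : ι → Quad D, (∀ i, dist (Q' i) (Q i) < δ) →
      P.real (⋂ i, QuadConfig.crossedEvent (Q' i)) ≤
        P.real (⋂ i, QuadConfig.crossedEvent (Q i)) + ε := by
  have h := (ENNReal.tendsto_toReal (measure_ne_top P (⋂ i, QuadConfig.crossedEvent (Q i)))).comp
    (cylinder_tendsto_measure_iInter_someCrossed P Q)
  have hev : ∀ᶠ k : ℕ in atTop,
      (P (⋂ i, QuadConfig.someCrossed (ball (Q i) (1 / ((k : ℝ) + 1))))).toReal <
        P.real (⋂ i, QuadConfig.crossedEvent (Q i)) + ε :=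
    h (Iio_mem_nhds (lt_add_of_pos_right _ hε))
  obtain ⟨k, hk⟩ := hev.exists
  refine ⟨1 / ((k : ℝ) + 1), by positivity, fun Q' hQ' => ?_⟩
  have hsub : ⋂ i, QuadConfig.crossedEvent (Q' i) ⊆
      ⋂ i, QuadConfig.someCrossed (ball (Q i) (1 / ((k : ℝ) + 1))) :=
    iInter_mono fun i S hS => ⟨Q' i, hS, mem_ball.2 (hQ' i)⟩
  calc P.real (⋂ i, QuadConfig.crossedEvent (Q' i))
      ≤ P.real (⋂ i, QuadConfig.someCrossed (ball (Q i) (1 / ((k : ℝ) + 1)))) :=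
        measureReal_mono hsub (measure_ne_top P _)
    _ ≤ P.real (⋂ i, QuadConfig.crossedEvent (Q i)) + ε := hk.le

/-- **Upper semicontinuity of unions of crossing events**: for every finite law, families of quads
coordinatewise close to the finite family `(Qᵢ)ᵢ` have some member crossed with probability at
most `P(⋃ᵢ ⊞_{Qᵢ}) + ε`. [folklore] -/
theorem measureReal_iUnion_crossedEvent_le_add_of_dist_lt {ι : Type*} [Finite ι]
    (P : Measure (QuadConfig D)) [IsFiniteMeasure P] (Q : ι → Quad D) {ε : ℝ} (hε : 0 < ε) :
    ∃ δ > 0, ∀ Q' : ι → Quad D, (∀ i, dist (Q' i) (Q i) < δ) →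
      P.real (⋃ i, QuadConfig.crossedEvent (Q' i)) ≤
        P.real (⋃ i, QuadConfig.crossedEvent (Q i)) + ε := by
  have h := (ENNReal.tendsto_toReal (measure_ne_top P (⋃ i, QuadConfig.crossedEvent (Q i)))).comp
    (cylinder_tendsto_measure_iUnion_someCrossed P Q)
  have hev : ∀ᶠ k : ℕ in atTop,
      (P (⋃ i, QuadConfig.someCrossed (ball (Q i) (1 / ((k : ℝ) + 1))))).toReal <
        P.real (⋃ i, QuadConfig.crossedEvent (Q i)) + ε :=
    h (Iio_mem_nhds (lt_add_of_pos_right _ hε))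
  obtain ⟨k, hk⟩ := hev.exists
  refine ⟨1 / ((k : ℝ) + 1), by positivity, fun Q' hQ' => ?_⟩
  have hsub : ⋃ i, QuadConfig.crossedEvent (Q' i) ⊆
      ⋃ i, QuadConfig.someCrossed (ball (Q i) (1 / ((k : ℝ) + 1))) :=
    iUnion_mono fun i S hS => ⟨Q' i, hS, mem_ball.2 (hQ' i)⟩
  calc P.real (⋃ i, QuadConfig.crossedEvent (Q' i))
      ≤ P.real (⋃ i, QuadConfig.someCrossed (ball (Q i) (1 / ((k : ℝ) + 1)))) :=
        measureReal_mono hsub (measure_ne_top P _)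
    _ ≤ P.real (⋃ i, QuadConfig.crossedEvent (Q i)) + ε := hk.le

/-! ### (D) on a crossing cylinder, and continuity -/

/-- **(D) on the full crossing cylinder**: `P(⋂ᵢ ⊞_{Qᵢ}) = 1 - P(⋃ᵢ ⊞_{Qtᵢ})` for every family
of transposes `Qtᵢ` of the `Qᵢ` (take `A = {univ}` in (D)). [folklore] -/
theorem measureReal_iInter_crossedEvent_eq_one_sub_transpose
    (P : Measure (QuadConfig (univ : Set ℂ))) [IsProbabilityMeasure P]
    (hD : ∀ (n : ℕ) (Q Qt : Fin n → Quad (univ : Set ℂ)),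
      (∀ i, (Qt i).carrier = (Q i).carrier ∧ (Qt i).side 0 = (Q i).side 1 ∧
        (Qt i).side 1 = (Q i).side 2 ∧ (Qt i).side 2 = (Q i).side 3 ∧ (Qt i).side 3 = (Q i).side 0) →
      ∀ A : Set (Set (Fin n)), P {S | {i | Q i ∈ S} ∈ A} = P {S | {i | Qt i ∉ S} ∈ A})
    {n : ℕ} (Q Qt : Fin n → Quad (univ : Set ℂ))
    (ht : ∀ i, (Qt i).carrier = (Q i).carrier ∧ (Qt i).side 0 = (Q i).side 1 ∧
      (Qt i).side 1 = (Q i).side 2 ∧ (Qt i).side 2 = (Q i).side 3 ∧ (Qt i).side 3 = (Q i).side 0) :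
    P.real (⋂ i, QuadConfig.crossedEvent (Q i)) =
      1 - P.real (⋃ i, QuadConfig.crossedEvent (Qt i)) := by
  have key := hD n Q Qt ht {univ}
  have hL : {S : QuadConfig (univ : Set ℂ) | {i : Fin n | Q i ∈ S} ∈ ({univ} : Set (Set (Fin n)))}
      = ⋂ i, QuadConfig.crossedEvent (Q i) := by
    ext S
    simp only [mem_setOf_eq, mem_singleton_iff, eq_univ_iff_forall, mem_iInter,
      QuadConfig.mem_crossedEvent]
  have hR : {S : QuadConfig (univ : Set ℂ) | {i : Fin n | Qt i ∉ S} ∈ ({univ} : Set (Set (Fin n)))}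
      = (⋃ i, QuadConfig.crossedEvent (Qt i))ᶜ := by
    ext S
    simp only [mem_setOf_eq, mem_singleton_iff, eq_univ_iff_forall, mem_compl_iff, mem_iUnion,
      QuadConfig.mem_crossedEvent, not_exists]
  rw [hL, hR, prob_compl_eq_one_sub
    (MeasurableSet.iUnion fun i => QuadConfig.measurableSet_crossedEvent (Qt i))] at key
  simp only [Measure.real, key]
  rw [ENNReal.toReal_sub_of_le prob_le_one ENNReal.one_ne_top, ENNReal.toReal_one]

/-- **Continuity of crossing-cylinder probabilities under exact self-duality** (stub
`continuous_measureReal_iInter_crossedEvent` of item stmt-CriticalPhenomena-14826): for an exactly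
self-dual probability law on `ℋ_ℂ`, `(Qᵢ)ᵢ ↦ P(⋂ᵢ ⊞_{Qᵢ})` is continuous on `Fin n → 𝒬_ℂ`: upper
semicontinuity is free, and `P(⋂ᵢ ⊞_{Qᵢ}) = 1 - P(⋃ᵢ ⊞_{Qtᵢ})` with the `1`-Lipschitz cyclic
transposes turns upper semicontinuity of the union into lower semicontinuity. [folklore] -/
theorem continuous_measureReal_iInter_crossedEvent : ∀ (P : Measure (QuadConfig (Set.univ : Set ℂ))), IsProbabilityMeasure P → (∀ (n : ℕ) (Q Qt : Fin n → Quad (Set.univ : Set ℂ)), (∀ i, (Qt i).carrier = (Q i).carrier ∧ (Qt i).side 0 = (Q i).side 1 ∧ (Qt i).side 1 = (Q i).side 2 ∧ (Qt i).side 2 = (Q i).side 3 ∧ (Qt i).side 3 = (Q i).side 0) → ∀ A : Set (Set (Fin n)), P {S | {i | Q i ∈ S} ∈ A} = P {S | {i | Qt i ∉ S} ∈ A}) → ∀ (n : ℕ), Continuous fun Q : Fin n → Quad (Set.univ : Set ℂ) => P.real (⋂ i, QuadConfig.crossedEvent (Q i)) := by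
  intro P hP hD n
  rw [Metric.continuous_iff]
  intro Q ε hε
  choose Qt ht hlip using fun i => exists_cyclicTranspose_lipschitz (Q i)
  obtain ⟨δ₁, hδ₁, h₁⟩ := measureReal_iInter_crossedEvent_le_add_of_dist_lt P Q (half_pos hε)
  obtain ⟨δ₂, hδ₂, h₂⟩ := measureReal_iUnion_crossedEvent_le_add_of_dist_lt P Qt (half_pos hε)
  refine ⟨min δ₁ δ₂, lt_min hδ₁ hδ₂, fun Q' hQ' => ?_⟩
  choose Qt' ht' hd using fun i => hlip i (Q' i)
  have hQ'i : ∀ i, dist (Q' i) (Q i) < min δ₁ δ₂ := fun i => (dist_le_pi_dist Q' Q i).trans_lt hQ'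
  have hup : P.real (⋂ i, QuadConfig.crossedEvent (Q' i)) ≤
      P.real (⋂ i, QuadConfig.crossedEvent (Q i)) + ε / 2 :=
    h₁ Q' fun i => (hQ'i i).trans_le (min_le_left _ _)
  have hQt' : ∀ i, dist (Qt' i) (Qt i) < δ₂ := fun i =>
    calc dist (Qt' i) (Qt i) = dist (Qt i) (Qt' i) := dist_comm _ _
      _ ≤ dist (Q i) (Q' i) := hd i
      _ = dist (Q' i) (Q i) := dist_comm _ _
      _ < δ₂ := (hQ'i i).trans_le (min_le_right _ _)
  have hup' : P.real (⋃ i, QuadConfig.crossedEvent (Qt' i)) ≤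
      P.real (⋃ i, QuadConfig.crossedEvent (Qt i)) + ε / 2 :=
    h₂ Qt' hQt'
  have e₁ := measureReal_iInter_crossedEvent_eq_one_sub_transpose P hD Q Qt ht
  have e₂ := measureReal_iInter_crossedEvent_eq_one_sub_transpose P hD Q' Qt' ht'
  rw [Real.dist_eq, abs_lt]
  constructor <;> linarith

end Summit.CriticalPhenomena.CardyFormulaZ2.Theorems.CardyMeckeFlip

end
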